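import Summits.RiemannHypothesis.RiemannHypothesis.Theorems.Splittings.SplitXWucK1RH
import HarnessLib

/-!
# Splittings — x-wuc GEN-11 `SplitXWucK1R` (K1′(ℝ) AT THE STAKE) — mechanical carve part 9/14
Continuation of `Summits.RiemannHypothesis.RiemannHypothesis.Theorems.Splittings.SplitXWucK1RH`: byte-identical declaration units of the referee-passed extract `SplitXWucK1R.lean`
sha16 70c8eb2af2868881 (x-wuc g11; ref g10 PASS 2026-08-27T22:59:46Z; RULING #330); open namespaces/sections re-opened with their context.
HONEST LABEL: splitting search over kernel-typed RH-equivalences; K-CERT′ (complex `f`) stays OPEN; nothing here bears on the truth of RH.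
-/
set_option linter.dupNamespace false
noncomputable section
open scoped Classical ComplexConjugate
open Set Filter Topology Complex MeasureTheory
open Real Set Filter Topology
open Real Set MeasureTheory Complex Filter Topology
open scoped Real
namespace Summit.RiemannHypothesis.RiemannHypothesis.Theorems.Splittings.XWucG8
namespace DSLine
section localds
/-- **LOCAL Duffin–Schaeffer bound**: `‖sin ω · T(y) + cos ω · T₁(y)‖ ≤ s·Mloc + (1 − s)·M`, `s = dsTrunc ω R`, whenever `‖T‖ ≤ Mloc` on
`[y − R, y + R]` and `‖T‖ ≤ M` on `ℝ` (`cos ω ≠ 0`). -/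
theorem norm_sin_mul_add_cos_mul_le_local (f : ℝ → ℂ) (hf : Continuous f) {M Mloc R : ℝ}
    (hM : ∀ y : ℝ, ‖tfT f y 0‖ ≤ M) (ω y : ℝ) (hloc : ∀ z : ℝ, |z - y| ≤ R → ‖tfT f z 0‖ ≤ Mloc)
    (hω : Real.cos ω ≠ 0) :
    ‖(Real.sin ω : ℂ) * tfT f y 0 + (Real.cos ω : ℂ) * tfT₁ f y‖ ≤ dsTrunc ω R * Mloc + (1 - dsTrunc ω R) * M := by
  haveI : Fact ((0 : ℝ) < 2) := ⟨two_pos⟩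
  have hI : IntervalIntegrable (fun u : ℝ => f u * (Real.cosh (0 * u) : ℂ) * cexp (I * (y : ℂ) * u))
      volume (-1) 1 := by apply Continuous.intervalIntegrable; fun_prop
  have hI₁ : IntervalIntegrable (fun u : ℝ => I * u * f u * (Real.cosh (0 * u) : ℂ) * cexp (I * (y : ℂ) * u))
      volume (-1) 1 := by apply Continuous.intervalIntegrable; fun_prop
  have key : (Real.sin ω : ℂ) * tfT f y 0 + (Real.cos ω : ℂ) * tfT₁ f y
      = ∫ u in (-1 : ℝ)..1, f u * dsKer ω u * cexp (I * ((y - (ω + π / 2) : ℝ) : ℂ) * u) := by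
    rw [tfT₁, CoshKernel.tfT_interval, CoshKernel.tfT_interval, ← intervalIntegral.integral_const_mul,
      ← intervalIntegral.integral_const_mul, ← intervalIntegral.integral_add (hI.const_mul _) (hI₁.const_mul _)]
    apply intervalIntegral.integral_congr
    intro u _
    simp only [dsKer]
    rw [zero_mul, Real.cosh_zero, Complex.ofReal_one, mul_one, mul_one,
      show cexp (I * (y : ℂ) * u) = cexp (I * ((ω + π / 2 : ℝ) : ℂ) * u) * cexp (I * ((y - (ω + π / 2) : ℝ) : ℂ) * u) by
        rw [← Complex.exp_add]; congr 1; push_cast; ring]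
    ring
  rw [key]
  have h := norm_engine_le_local (dsKer ω) (dsKer_continuous ω) (dsKer_per ω)
    (summable_norm_fourierCoeff_dsKer hω) f hf (y - (ω + π / 2))
    (Finset.Icc ⌈(ω + π / 2 - R) / π⌉ ⌊(ω + π / 2 + R) / π⌋) (Mloc := Mloc) (M := M) ?_ hM
  · rw [tsum_norm_fourierCoeff_dsKer hω] at h
    simp_rw [fourierCoeff_dsKer hω] at h
    exact h
  · intro n hn
    apply hloc
    have e : y - (ω + π / 2) + π * n - y = π * n - (ω + π / 2) := by ring
    rw [e]; exact mem_dsTrunc_index hn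

/-- `dsTrunc_le_one` — helper of the x-wuc GEN-11 chain «K1′(ℝ) at the stake» (verbatim from the referee-passed extract `SplitXWucK1R.lean` 70c8eb2af2868881; role: see the module docstring). -/
theorem dsTrunc_le_one {ω : ℝ} (hω : Real.cos ω ≠ 0) (R : ℝ) : dsTrunc ω R ≤ 1 := by
  haveI : Fact ((0 : ℝ) < 2) := ⟨two_pos⟩
  rw [dsTrunc, ← (hasSum_norm_dsCoeff hω).tsum_eq]
  exact (hasSum_norm_dsCoeff hω).summable.sum_le_tsum _ (fun n _ => norm_nonneg _)

/-- **LOCAL DS, real form**: with a uniform tail bound `1 − dsTrunc ω R ≤ τ` (a pure series estimate, `τ ≈ 2/(πR)`), for `‖c‖ ≤ 1`: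
`Re(c·T(y))² + Re(c·T₁(y))² ≤ (Mloc + τ(M − Mloc))²` — the input of the DS lobe with the LOCAL sup `Mloc` in place of `M`. -/
theorem re_sq_add_re_sq_le_local (f : ℝ → ℂ) (hf : Continuous f) {M Mloc R τ : ℝ}
    (hM : ∀ y : ℝ, ‖tfT f y 0‖ ≤ M) (y : ℝ) (hR : 0 ≤ R) (hloc : ∀ z : ℝ, |z - y| ≤ R → ‖tfT f z 0‖ ≤ Mloc)
    (hMloc : Mloc ≤ M) (hτ : 0 ≤ τ) (htail : ∀ ω : ℝ, Real.cos ω ≠ 0 → 1 - dsTrunc ω R ≤ τ)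
    (c : ℂ) (hc : ‖c‖ ≤ 1) :
    (c * tfT f y 0).re ^ 2 + (c * tfT₁ f y).re ^ 2 ≤ (Mloc + τ * (M - Mloc)) ^ 2 := by
  have hMloc0 : 0 ≤ Mloc := (norm_nonneg _).trans (hloc y (by simp [hR]))
  have hM'0 : 0 ≤ Mloc + τ * (M - Mloc) := by nlinarith
  have hTy : ‖c * tfT f y 0‖ ≤ Mloc := by
    rw [norm_mul]
    calc ‖c‖ * ‖tfT f y 0‖ ≤ 1 * Mloc := by gcongr; exact hloc y (by simp [hR])
      _ = Mloc := one_mul _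
  set a : ℝ := (c * tfT f y 0).re with ha
  set b : ℝ := (c * tfT₁ f y).re with hb
  set z : ℂ := ⟨b, a⟩ with hz
  by_cases h0 : z = 0
  · have hb0 : b = 0 := by have := congrArg Complex.re h0; simpa [hz] using this
    have ha0 : a = 0 := by have := congrArg Complex.im h0; simpa [hz] using this
    rw [ha0, hb0]; nlinarith [sq_nonneg (Mloc + τ * (M - Mloc))]
  · set ω : ℝ := Complex.arg z with hω
    have hcos : Real.cos ω = b / ‖z‖ := by rw [hω, Complex.cos_arg h0]
    have hsin : Real.sin ω = a / ‖z‖ := by rw [hω, Complex.sin_arg]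
    have hzn : 0 < ‖z‖ := norm_pos_iff.mpr h0
    have hz2 : ‖z‖ ^ 2 = b ^ 2 + a ^ 2 := by
      rw [Complex.sq_norm, Complex.normSq_apply, hz]; ring
    by_cases hcosω : Real.cos ω = 0
    · -- then `b = 0` and `a² ≤ ‖c T(y)‖² ≤ Mloc²`
      have hb0 : b = 0 := by
        have := hcos; rw [hcosω] at this
        field_simp at this; linarith [this]
      have ha2 : a ^ 2 ≤ Mloc ^ 2 := by
        have h1 : |a| ≤ ‖c * tfT f y 0‖ := Complex.abs_re_le_norm _
        have h2 : |a| ≤ Mloc := h1.trans hTy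
        calc a ^ 2 = |a| ^ 2 := (sq_abs a).symm
          _ ≤ Mloc ^ 2 := pow_le_pow_left₀ (abs_nonneg a) h2 2
      rw [hb0]
      nlinarith [mul_nonneg hτ (sub_nonneg.mpr hMloc), hMloc0]
    have h0 := norm_sin_mul_add_cos_mul_le_local f hf hM ω y hloc hcosω
    have h : ‖(Real.sin ω : ℂ) * tfT f y 0 + (Real.cos ω : ℂ) * tfT₁ f y‖ ≤ Mloc + τ * (M - Mloc) := by
      refine h0.trans ?_
      have h1 := htail ω hcosω
      have h2 : 0 ≤ M - Mloc := sub_nonneg.mpr hMloc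
      nlinarith
    -- Re(c · (sin ω T + cos ω T₁)) = sin ω a + cos ω b = ‖z‖
    have hre : (c * ((Real.sin ω : ℂ) * tfT f y 0 + (Real.cos ω : ℂ) * tfT₁ f y)).re = ‖z‖ := by
      rw [mul_add, show c * ((Real.sin ω : ℂ) * tfT f y 0) = (Real.sin ω : ℂ) * (c * tfT f y 0) by ring,
        show c * ((Real.cos ω : ℂ) * tfT₁ f y) = (Real.cos ω : ℂ) * (c * tfT₁ f y) by ring,
        Complex.add_re, Complex.re_ofReal_mul, Complex.re_ofReal_mul, ← ha, ← hb, hsin, hcos]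
      field_simp
      rw [hz2]; ring
    have h1 : ‖z‖ ≤ Mloc + τ * (M - Mloc) := by
      calc ‖z‖ = (c * ((Real.sin ω : ℂ) * tfT f y 0 + (Real.cos ω : ℂ) * tfT₁ f y)).re := hre.symm
        _ ≤ ‖c * ((Real.sin ω : ℂ) * tfT f y 0 + (Real.cos ω : ℂ) * tfT₁ f y)‖ := Complex.re_le_norm _
        _ = ‖c‖ * ‖(Real.sin ω : ℂ) * tfT f y 0 + (Real.cos ω : ℂ) * tfT₁ f y‖ := norm_mul _ _
        _ ≤ 1 * (Mloc + τ * (M - Mloc)) := by gcongr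
        _ = Mloc + τ * (M - Mloc) := one_mul _
    calc a ^ 2 + b ^ 2 = ‖z‖ ^ 2 := by rw [hz2]; ring
      _ ≤ (Mloc + τ * (M - Mloc)) ^ 2 := pow_le_pow_left₀ hzn.le h1 2

end localds
end DSLine
end Summit.RiemannHypothesis.RiemannHypothesis.Theorems.Splittings.XWucG8
open Real Set MeasureTheory Complex Filter Topology
open scoped Real
namespace Summit.RiemannHypothesis.RiemannHypothesis.Theorems.Splittings.XWucG8
namespace DSLine
/-- finite telescoping: `Σ_{k<K} 1/(R+πk)² ≤ 1/R² + 1/(πR)`. -/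
theorem sum_inv_sq_shift_le {R : ℝ} (hR : 0 < R) (K : ℕ) :
    ∑ k ∈ Finset.range K, 1 / (R + π * k) ^ 2 ≤ 1 / R ^ 2 + 1 / (π * R) := by
  have hπ := Real.pi_pos
  cases K with
  | zero => simp only [Finset.range_zero, Finset.sum_empty]; positivity
  | succ K =>
    rw [Finset.sum_range_succ']
    have h0 : 1 / (R + π * ((0 : ℕ) : ℝ)) ^ 2 = 1 / R ^ 2 := by simp
    have hstep : ∀ k : ℕ, 1 / (R + π * ((k + 1 : ℕ) : ℝ)) ^ 2
        ≤ (1 / π) * (1 / (R + π * k) - 1 / (R + π * ((k + 1 : ℕ) : ℝ))) := by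
      intro k
      have ha : 0 < R + π * k := by positivity
      have hb : 0 < R + π * ((k + 1 : ℕ) : ℝ) := by positivity
      have e : (1 / π) * (1 / (R + π * k) - 1 / (R + π * ((k + 1 : ℕ) : ℝ)))
          = 1 / ((R + π * k) * (R + π * ((k + 1 : ℕ) : ℝ))) := by
        field_simp
        push_cast
        ring
      rw [e]
      apply one_div_le_one_div_of_le (mul_pos ha hb)
      have : R + π * k ≤ R + π * ((k + 1 : ℕ) : ℝ) := by push_cast; nlinarith
      nlinarith
    have hKt : 0 ≤ 1 / (R + π * ((K : ℕ) : ℝ)) := by positivity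
    calc ∑ k ∈ Finset.range K, 1 / (R + π * ((k + 1 : ℕ) : ℝ)) ^ 2 + 1 / (R + π * ((0 : ℕ) : ℝ)) ^ 2
        ≤ ∑ k ∈ Finset.range K, (1 / π) * (1 / (R + π * k) - 1 / (R + π * ((k + 1 : ℕ) : ℝ))) + 1 / R ^ 2 :=
          add_le_add (Finset.sum_le_sum (fun k _ => hstep k)) h0.le
      _ = (1 / π) * (1 / R - 1 / (R + π * ((K : ℕ) : ℝ))) + 1 / R ^ 2 := by
          rw [← Finset.mul_sum, Finset.sum_range_sub']
          simp
      _ ≤ (1 / π) * (1 / R) + 1 / R ^ 2 := by gcongr; linarith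
      _ = 1 / R ^ 2 + 1 / (π * R) := by rw [one_div_mul_one_div]; ring

/-- **generic DS tail bound.** If `0 ≤ c n ≤ 1/(s − πn)²` and `Σ c = 1` then the mass outside the window
`⌈(s−R)/π⌉ ≤ n ≤ ⌊(s+R)/π⌋` is at most `2/(πR) + 2/R²` (`π ≤ R`). -/
theorem one_sub_window_sum_le (s R : ℝ) (hR : π ≤ R) (c : ℤ → ℝ) (hc0 : ∀ n, 0 ≤ c n) (hcs : HasSum c 1)
    (hcle : ∀ n : ℤ, c n ≤ 1 / (s - π * n) ^ 2) :
    1 - ∑ n ∈ Finset.Icc ⌈(s - R) / π⌉ ⌊(s + R) / π⌋, c n ≤ 2 / (π * R) + 2 / R ^ 2 := by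
  have hπ := Real.pi_pos
  have hR0 : 0 < R := lt_of_lt_of_le hπ hR
  set A : ℤ := ⌈(s - R) / π⌉ with hA
  set B : ℤ := ⌊(s + R) / π⌋ with hB
  have hBlt : s + R < π * B + π := by
    have h := Int.lt_floor_add_one ((s + R) / π)
    rw [← hB] at h
    rw [div_lt_iff₀ hπ] at h
    linarith [h]
  have hAlt : π * A - π < s - R := by
    have h := Int.ceil_lt_add_one ((s - R) / π)
    rw [← hA] at h
    have h' : (A : ℝ) - 1 < (s - R) / π := by linarith
    rw [lt_div_iff₀ hπ] at h'
    linarith [h']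
  have hAB : A ≤ B + 1 := by
    have h1 : (A : ℝ) < (s - R) / π + 1 := by
      have := Int.ceil_lt_add_one ((s - R) / π); rwa [← hA] at this
    have h2 : (s + R) / π < B + 1 := by
      have := Int.lt_floor_add_one ((s + R) / π); rwa [← hB] at this
    have h3 : (s - R) / π + 1 ≤ (s + R) / π := by
      rw [div_add_one hπ.ne', div_le_div_iff_of_pos_right hπ]; linarith
    have : (A : ℝ) < B + 1 := by linarith
    exact_mod_cast this.le
  -- one-sided bounds
  have hright : ∀ n : ℤ, B < n → c n ≤ 1 / (R + π * (((n - B - 1 : ℤ)) : ℝ)) ^ 2 := by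
    intro n hn
    have hk0 : (0 : ℝ) ≤ ((n - B - 1 : ℤ) : ℝ) := by exact_mod_cast (by omega : (0 : ℤ) ≤ n - B - 1)
    have h1 : R + π * (((n - B - 1 : ℤ)) : ℝ) ≤ π * n - s := by push_cast; nlinarith
    have h2 : 0 < R + π * (((n - B - 1 : ℤ)) : ℝ) := by positivity
    calc c n ≤ 1 / (s - π * n) ^ 2 := hcle n
      _ = 1 / (π * n - s) ^ 2 := by rw [show (s - π * n) ^ 2 = (π * n - s) ^ 2 by ring]
      _ ≤ 1 / (R + π * (((n - B - 1 : ℤ)) : ℝ)) ^ 2 :=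
          one_div_le_one_div_of_le (pow_pos h2 2) (pow_le_pow_left₀ h2.le h1 2)
  have hleft : ∀ n : ℤ, n < A → c n ≤ 1 / (R + π * (((A - 1 - n : ℤ)) : ℝ)) ^ 2 := by
    intro n hn
    have hk0 : (0 : ℝ) ≤ ((A - 1 - n : ℤ) : ℝ) := by exact_mod_cast (by omega : (0 : ℤ) ≤ A - 1 - n)
    have h1 : R + π * (((A - 1 - n : ℤ)) : ℝ) ≤ s - π * n := by push_cast; nlinarith
    have h2 : 0 < R + π * (((A - 1 - n : ℤ)) : ℝ) := by positivity
    calc c n ≤ 1 / (s - π * n) ^ 2 := hcle n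
      _ ≤ 1 / (R + π * (((A - 1 - n : ℤ)) : ℝ)) ^ 2 :=
          one_div_le_one_div_of_le (pow_pos h2 2) (pow_le_pow_left₀ h2.le h1 2)
  -- finite partial sums are bounded
  have key : ∀ F : Finset ℤ, ∑ n ∈ F, c n ≤ (∑ n ∈ Finset.Icc A B, c n) + (2 / (π * R) + 2 / R ^ 2) := by
    intro F
    obtain ⟨N, hN⟩ := F.bddAbove
    obtain ⟨L, hL⟩ := F.bddBelow
    rw [← Finset.sum_filter_add_sum_filter_not F (fun n => n ∈ Finset.Icc A B)]
    have h1 : ∑ n ∈ F.filter (fun n => n ∈ Finset.Icc A B), c n ≤ ∑ n ∈ Finset.Icc A B, c n := by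
      apply Finset.sum_le_sum_of_subset_of_nonneg
      · intro n hn; exact (Finset.mem_filter.mp hn).2
      · intro n _ _; exact hc0 n
    -- right tail
    have hr : ∑ n ∈ F.filter (fun n => B < n), c n ≤ 1 / R ^ 2 + 1 / (π * R) := by
      set K : ℕ := (N - B).toNat with hK
      let emb : ℕ ↪ ℤ := ⟨fun k => B + 1 + (k : ℤ), fun a b h => by simpa using h⟩
      have hsub : F.filter (fun n => B < n) ⊆ (Finset.range K).map emb := by
        intro n hn
        rw [Finset.mem_filter] at hn
        have hnN : n ≤ N := hN hn.1
        rw [Finset.mem_map]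
        refine ⟨(n - B - 1).toNat, ?_, ?_⟩
        · rw [Finset.mem_range]; omega
        · simp only [emb, Function.Embedding.coeFn_mk]; omega
      calc ∑ n ∈ F.filter (fun n => B < n), c n
          ≤ ∑ n ∈ F.filter (fun n => B < n), 1 / (R + π * (((n - B - 1 : ℤ)) : ℝ)) ^ 2 :=
            Finset.sum_le_sum (fun n hn => hright n (Finset.mem_filter.mp hn).2)
        _ ≤ ∑ n ∈ (Finset.range K).map emb, 1 / (R + π * (((n - B - 1 : ℤ)) : ℝ)) ^ 2 :=
            Finset.sum_le_sum_of_subset_of_nonneg hsub (fun n _ _ => by positivity)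
        _ = ∑ k ∈ Finset.range K, 1 / (R + π * k) ^ 2 := by
            rw [Finset.sum_map]
            apply Finset.sum_congr rfl
            intro k _
            simp only [emb, Function.Embedding.coeFn_mk]
            rw [show (B + 1 + (k : ℤ) - B - 1 : ℤ) = k by ring]
            push_cast; rfl
        _ ≤ 1 / R ^ 2 + 1 / (π * R) := sum_inv_sq_shift_le hR0 K
    -- left tail
    have hl : ∑ n ∈ F.filter (fun n => n < A), c n ≤ 1 / R ^ 2 + 1 / (π * R) := by
      set K : ℕ := (A - L).toNat with hK
      let emb : ℕ ↪ ℤ := ⟨fun k => A - 1 - (k : ℤ), fun a b h => by simpa using h⟩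
      have hsub : F.filter (fun n => n < A) ⊆ (Finset.range K).map emb := by
        intro n hn
        rw [Finset.mem_filter] at hn
        have hnL : L ≤ n := hL hn.1
        rw [Finset.mem_map]
        refine ⟨(A - 1 - n).toNat, ?_, ?_⟩
        · rw [Finset.mem_range]; omega
        · simp only [emb, Function.Embedding.coeFn_mk]; omega
      calc ∑ n ∈ F.filter (fun n => n < A), c n
          ≤ ∑ n ∈ F.filter (fun n => n < A), 1 / (R + π * (((A - 1 - n : ℤ)) : ℝ)) ^ 2 :=
            Finset.sum_le_sum (fun n hn => hleft n (Finset.mem_filter.mp hn).2)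
        _ ≤ ∑ n ∈ (Finset.range K).map emb, 1 / (R + π * (((A - 1 - n : ℤ)) : ℝ)) ^ 2 :=
            Finset.sum_le_sum_of_subset_of_nonneg hsub (fun n _ _ => by positivity)
        _ = ∑ k ∈ Finset.range K, 1 / (R + π * k) ^ 2 := by
            rw [Finset.sum_map]
            apply Finset.sum_congr rfl
            intro k _
            simp only [emb, Function.Embedding.coeFn_mk]
            rw [show (A - 1 - (A - 1 - (k : ℤ)) : ℤ) = k by ring]
            push_cast; rfl
        _ ≤ 1 / R ^ 2 + 1 / (π * R) := sum_inv_sq_shift_le hR0 K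
    have hsub2 : F.filter (fun n => ¬ n ∈ Finset.Icc A B) ⊆ F.filter (fun n => B < n) ∪ F.filter (fun n => n < A) := by
      intro n hn
      rw [Finset.mem_filter, Finset.mem_Icc, not_and_or, not_le, not_le] at hn
      rw [Finset.mem_union, Finset.mem_filter, Finset.mem_filter]
      rcases hn.2 with h | h
      · exact Or.inr ⟨hn.1, h⟩
      · exact Or.inl ⟨hn.1, h⟩
    have hdisj : Disjoint (F.filter (fun n => B < n)) (F.filter (fun n => n < A)) := by
      rw [Finset.disjoint_filter]; intro n _ h1 h2; omega
    have h2 : ∑ n ∈ F.filter (fun n => ¬ n ∈ Finset.Icc A B), c n ≤ 2 / (π * R) + 2 / R ^ 2 := by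
      calc ∑ n ∈ F.filter (fun n => ¬ n ∈ Finset.Icc A B), c n
          ≤ ∑ n ∈ F.filter (fun n => B < n) ∪ F.filter (fun n => n < A), c n :=
            Finset.sum_le_sum_of_subset_of_nonneg hsub2 (fun n _ _ => hc0 n)
        _ = ∑ n ∈ F.filter (fun n => B < n), c n + ∑ n ∈ F.filter (fun n => n < A), c n :=
            Finset.sum_union hdisj
        _ ≤ (1 / R ^ 2 + 1 / (π * R)) + (1 / R ^ 2 + 1 / (π * R)) := add_le_add hr hl
        _ = 2 / (π * R) + 2 / R ^ 2 := by ring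
    linarith
  have ht : (1 : ℝ) ≤ (∑ n ∈ Finset.Icc A B, c n) + (2 / (π * R) + 2 / R ^ 2) := le_of_tendsto' hcs key
  linarith

/-- **DS tail lemma**: `1 − dsTrunc ω R ≤ 2/(πR) + 2/R²` for `cos ω ≠ 0`, `π ≤ R`. -/
theorem one_sub_dsTrunc_le {ω R : ℝ} (hω : Real.cos ω ≠ 0) (hR : π ≤ R) :
    1 - dsTrunc ω R ≤ 2 / (π * R) + 2 / R ^ 2 := by
  haveI : Fact ((0 : ℝ) < 2) := ⟨two_pos⟩
  have h := one_sub_window_sum_le (ω + π / 2) R hR (fun n => ‖(dsCoeff ω n : ℂ)‖) (fun n => norm_nonneg _)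
    (hasSum_norm_dsCoeff hω) (fun n => by
      show ‖(dsCoeff ω n : ℂ)‖ ≤ 1 / (ω + π / 2 - π * n) ^ 2
      rw [norm_dsCoeff hω]
      gcongr
      exact Real.cos_sq_le_one ω)
  simpa [dsTrunc] using h

/-- **LOCAL Duffin–Schaeffer with explicit tail**: for `π ≤ R`, `‖c‖ ≤ 1`, a local bound `Mloc` on `[y−R, y+R]` and a global bound
`M ≥ Mloc`: `Re(c·T(y))² + Re(c·T₁(y))² ≤ (Mloc + (2/(πR) + 2/R²)·(M − Mloc))²`. -/
theorem re_sq_add_re_sq_le_local' (f : ℝ → ℂ) (hf : Continuous f) {M Mloc R : ℝ}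
    (hM : ∀ y : ℝ, ‖tfT f y 0‖ ≤ M) (y : ℝ) (hR : π ≤ R) (hloc : ∀ z : ℝ, |z - y| ≤ R → ‖tfT f z 0‖ ≤ Mloc)
    (hMloc : Mloc ≤ M) (c : ℂ) (hc : ‖c‖ ≤ 1) :
    (c * tfT f y 0).re ^ 2 + (c * tfT₁ f y).re ^ 2 ≤ (Mloc + (2 / (π * R) + 2 / R ^ 2) * (M - Mloc)) ^ 2 := by
  have hR0 : 0 < R := lt_of_lt_of_le Real.pi_pos hR
  exact re_sq_add_re_sq_le_local f hf hM y hR0.le hloc hMloc (by positivity)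
    (fun ω hω => one_sub_dsTrunc_le hω hR) c hc

end DSLine
end Summit.RiemannHypothesis.RiemannHypothesis.Theorems.Splittings.XWucG8
open Real Set MeasureTheory Complex Filter Topology
open scoped Real
namespace Summit.RiemannHypothesis.RiemannHypothesis.Theorems.Splittings.XWucG8
end Summit.RiemannHypothesis.RiemannHypothesis.Theorems.Splittings.XWucG8
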